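import Mathlib
import Summits.Ventures.HodgeRepro2.T7SupportIntegratedForm
import Summits.Ventures.HodgeRepro2.Tier7.Line3.CompactUnimodular

/-!
# Tier7/Line3/InvariantProjector — averaging over a compact group is the orthogonal projection onto the invariants
(seat t7-L1-p2, gen 3)

LINE 3 (t7-plan-3), version (ii), memo v13 §2e (b): `R(f) = R(f_{ι₂}) R(f_{ι₃}) R(f_{ι₁}) R(f_fin)` with
`f_fin` the normalised characteristic function of the level subgroup `K_f`, and «`R(f)` maps `L²([G])` into the
finite-dimensional space of forms of level `K_f`» — the `R(f_fin)` factor is the averaging over the compact group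
`K_f`, which is the orthogonal projection onto the `K_f`-INVARIANT vectors. THIS FILE proves that projector property
in the kernel, for every unitary representation `π` of a compact group `K` on a Hilbert space `H` that is strongly
continuous (`∀ x, Continuous (k ↦ π k x)`), with `avg μ π x := ∫ k, π k x dμ` against the Haar probability `μ` —
p1's row 692 `integratedForm μ π 1` (the test function `f ≡ 1`):

* `pi_avg`: the average is `K`-invariant (left invariance of `μ`); `avg_of_fixed`: an invariant vector is its own
  average; hence `avg_avg` (idempotent) and **`range_avgCLM_eq_fixed`**: the range of the averaging operator IS the
  fixed subspace `fixed μ π = {x | ∀ k, π k x = x}`;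
* `adjointFn_one`: `1* = 1`, so row 692's `isSelfAdjoint_integratedFormCLM` + `CompactUnimodular` give
  **`isSelfAdjoint_avgCLM`**, **`isStarProjection_avgCLM`** and **`avgCLM_eq_starProjection_fixed`**:
  `avg = (fixed μ π).starProjection` — the orthogonal projection onto the invariants;
* `inner_avg_left_of_fixed` (`⟪avg x, y⟫ = ⟪x, y⟫` for invariant `y`), `norm_avg_le` (`‖avg x‖ ≤ ‖x‖`),
  `avg_eq_zero_of_mem_orthogonal_fixed` (the average kills the orthogonal complement of the invariants).

The finite-dimensionality of the level-`K_f` forms with prescribed archimedean types is printed (GH Thm 18.2.2 /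
DE 9.2.2) and is not touched here. Nothing here is about an adelic group, a period or (N); the identification of
`K_f ⊂ U(W_A)(𝔸_f)` acting on `L²([G])` by right translation with `(K, π, H)` is the dictionary (in words).
No sorry; axioms ⊆ {propext, Classical.choice, Quot.sound}.
-/

namespace Summit.Ventures.HodgeRepro2.Tier7.Line3.InvariantProjector

open MeasureTheory
open scoped InnerProductSpace
open Summit.Ventures.HodgeRepro2.T7SupportIntegratedForm (integratedForm integratedFormCLM integratedFormCLM_apply
  adjointFn IsStronglyMeasurable norm_apply integrable_smul isSelfAdjoint_integratedFormCLM norm_integratedForm_le)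

variable {K : Type*} [Group K] [TopologicalSpace K] [IsTopologicalGroup K] [CompactSpace K]
  [MeasurableSpace K] [BorelSpace K] (μ : Measure K)
variable {H : Type*} [NormedAddCommGroup H] [InnerProductSpace ℂ H] [CompleteSpace H]

/-- the constant test function `1` on `K`. -/
def one : K → ℂ := fun _ => 1

omit [Group K] [TopologicalSpace K] [IsTopologicalGroup K] [CompactSpace K] [MeasurableSpace K] [BorelSpace K] in
/-- `one k = 1`. -/
theorem one_apply (k : K) : one k = (1 : ℂ) := rfl

omit [TopologicalSpace K] [IsTopologicalGroup K] [CompactSpace K] [MeasurableSpace K] [BorelSpace K] in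
/-- `1* = 1`. -/
theorem adjointFn_one : adjointFn (one : K → ℂ) = one := by
  funext k
  simp only [adjointFn, one, map_one]

omit [Group K] [TopologicalSpace K] [IsTopologicalGroup K] [CompactSpace K] [BorelSpace K] in
/-- `1` is integrable against a finite measure. -/
theorem integrable_one [IsFiniteMeasure μ] : Integrable (one : K → ℂ) μ := integrable_const 1

omit [IsTopologicalGroup K] [CompleteSpace H] in
/-- strong continuity of `π` gives row 692's strong measurability. -/
theorem isStronglyMeasurable_of_continuous {π : K →* (H →ₗ[ℂ] H)} (hc : ∀ x, Continuous fun k => π k x) :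
    IsStronglyMeasurable μ π := fun x =>
  ((hc x).stronglyMeasurable_of_hasCompactSupport (HasCompactSupport.of_compactSpace _)).aestronglyMeasurable

/-- **the averaging operator** `avg μ π x := ∫ k, π k x dμ` — row 692's `integratedForm` with `f ≡ 1`. -/
noncomputable def avg (π : K →* (H →ₗ[ℂ] H)) (x : H) : H := integratedForm μ π one x

omit [TopologicalSpace K] [IsTopologicalGroup K] [CompactSpace K] [BorelSpace K] [CompleteSpace H] in
/-- `avg μ π x = ∫ k, π k x dμ`. -/
theorem avg_eq (π : K →* (H →ₗ[ℂ] H)) (x : H) : avg μ π x = ∫ k, π k x ∂μ := by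
  unfold avg integratedForm
  simp only [one, one_smul]

omit [IsTopologicalGroup K] [CompleteSpace H] in
/-- the integrand `k ↦ π k x` is integrable. -/
theorem integrable_apply [IsFiniteMeasure μ] {π : K →* (H →ₗ[ℂ] H)} (hc : ∀ x, Continuous fun k => π k x) (x : H) :
    Integrable (fun k => π k x) μ :=
  (hc x).integrable_of_hasCompactSupport (HasCompactSupport.of_compactSpace _)

/-- `π k` as a bounded operator (unitary, norm `1`-Lipschitz). -/
noncomputable def piCLM (π : K →* (H →ₗ[ℂ] H)) (hπ : T7SupportWeightTorusOrbital.IsUnitaryRep π) (k : K) :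
    H →L[ℂ] H :=
  LinearMap.mkContinuous (π k) 1 (fun y => by rw [norm_apply hπ, one_mul])

omit [TopologicalSpace K] [IsTopologicalGroup K] [CompactSpace K] [MeasurableSpace K] [BorelSpace K]
  [CompleteSpace H] in
/-- `piCLM π hπ k y = π k y`. -/
theorem piCLM_apply (π : K →* (H →ₗ[ℂ] H)) (hπ : T7SupportWeightTorusOrbital.IsUnitaryRep π) (k : K) (y : H) :
    piCLM π hπ k y = π k y := rfl

/-- **the average is invariant**: `π k (avg x) = avg x` (left invariance of `μ`). -/
theorem pi_avg [IsFiniteMeasure μ] [μ.IsMulLeftInvariant] {π : K →* (H →ₗ[ℂ] H)}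
    (hπ : T7SupportWeightTorusOrbital.IsUnitaryRep π) (hc : ∀ x, Continuous fun k => π k x) (k : K) (x : H) :
    π k (avg μ π x) = avg μ π x := by
  rw [avg_eq, ← piCLM_apply π hπ k, ← ContinuousLinearMap.integral_comp_comm _ (integrable_apply μ hc x)]
  have e : ∀ k', piCLM π hπ k (π k' x) = (fun k'' => π k'' x) (k * k') := by
    intro k'
    simp only [piCLM_apply]
    rw [map_mul π, Module.End.mul_apply]
  simp_rw [e]
  exact integral_mul_left_eq_self (fun k'' => π k'' x) k

omit [TopologicalSpace K] [IsTopologicalGroup K] [CompactSpace K] [BorelSpace K] in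
/-- **an invariant vector is its own average**. -/
theorem avg_of_fixed [IsProbabilityMeasure μ] (π : K →* (H →ₗ[ℂ] H)) {x : H} (hx : ∀ k, π k x = x) :
    avg μ π x = x := by
  rw [avg_eq]
  simp only [hx, integral_const, probReal_univ, one_smul]

/-- **the average is idempotent**. -/
theorem avg_avg [IsProbabilityMeasure μ] [μ.IsMulLeftInvariant] {π : K →* (H →ₗ[ℂ] H)}
    (hπ : T7SupportWeightTorusOrbital.IsUnitaryRep π) (hc : ∀ x, Continuous fun k => π k x) (x : H) :
    avg μ π (avg μ π x) = avg μ π x :=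
  avg_of_fixed μ π fun k => pi_avg μ hπ hc k x

/-- the subspace of `K`-invariant vectors. -/
def fixed (π : K →* (H →ₗ[ℂ] H)) : Submodule ℂ H where
  carrier := {x | ∀ k, π k x = x}
  add_mem' {x y} hx hy k := by rw [map_add, hx k, hy k]
  zero_mem' k := map_zero _
  smul_mem' c {x} hx k := by rw [map_smul, hx k]

omit [TopologicalSpace K] [IsTopologicalGroup K] [CompactSpace K] [MeasurableSpace K] [BorelSpace K]
  [CompleteSpace H] in
/-- membership in `fixed`. -/
theorem mem_fixed (π : K →* (H →ₗ[ℂ] H)) (x : H) : x ∈ fixed π ↔ ∀ k, π k x = x := Iff.rfl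

/-- **the averaging operator as a bounded operator** (row 692's `integratedFormCLM` with `f ≡ 1`). -/
noncomputable def avgCLM [IsFiniteMeasure μ] {π : K →* (H →ₗ[ℂ] H)} (hπ : T7SupportWeightTorusOrbital.IsUnitaryRep π)
    (hc : ∀ x, Continuous fun k => π k x) : H →L[ℂ] H :=
  integratedFormCLM μ hπ (isStronglyMeasurable_of_continuous μ hc) (integrable_one μ)

omit [IsTopologicalGroup K] [CompleteSpace H] in
/-- `avgCLM x = avg x`. -/
theorem avgCLM_apply [IsFiniteMeasure μ] {π : K →* (H →ₗ[ℂ] H)} (hπ : T7SupportWeightTorusOrbital.IsUnitaryRep π)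
    (hc : ∀ x, Continuous fun k => π k x) (x : H) : avgCLM μ hπ hc x = avg μ π x := rfl

/-- **the range of the averaging operator is the fixed subspace**. -/
theorem range_avgCLM_eq_fixed [IsProbabilityMeasure μ] [μ.IsMulLeftInvariant] {π : K →* (H →ₗ[ℂ] H)}
    (hπ : T7SupportWeightTorusOrbital.IsUnitaryRep π) (hc : ∀ x, Continuous fun k => π k x) :
    LinearMap.range (avgCLM μ hπ hc : H →ₗ[ℂ] H) = fixed π := by
  ext y
  constructor
  · rintro ⟨x, rfl⟩ k
    exact pi_avg μ hπ hc k x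
  · intro hy
    exact ⟨y, avg_of_fixed μ π hy⟩

/-- **the averaging operator is self-adjoint** (`1* = 1`; `μ` inversion-invariant by `CompactUnimodular`). -/
theorem isSelfAdjoint_avgCLM [μ.IsHaarMeasure] [IsProbabilityMeasure μ] {π : K →* (H →ₗ[ℂ] H)}
    (hπ : T7SupportWeightTorusOrbital.IsUnitaryRep π) (hc : ∀ x, Continuous fun k => π k x) :
    IsSelfAdjoint (avgCLM μ hπ hc) := by
  haveI := CompactUnimodular.isInvInvariant_of_compactSpace μ
  exact isSelfAdjoint_integratedFormCLM μ hπ _ _ adjointFn_one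

/-- **the averaging operator is idempotent**. -/
theorem isIdempotentElem_avgCLM [IsProbabilityMeasure μ] [μ.IsMulLeftInvariant] {π : K →* (H →ₗ[ℂ] H)}
    (hπ : T7SupportWeightTorusOrbital.IsUnitaryRep π) (hc : ∀ x, Continuous fun k => π k x) :
    IsIdempotentElem (avgCLM μ hπ hc) := by
  refine ContinuousLinearMap.ext fun x => ?_
  exact avg_avg μ hπ hc x

/-- **the averaging operator is a star projection**. -/
theorem isStarProjection_avgCLM [μ.IsHaarMeasure] [IsProbabilityMeasure μ] {π : K →* (H →ₗ[ℂ] H)}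
    (hπ : T7SupportWeightTorusOrbital.IsUnitaryRep π) (hc : ∀ x, Continuous fun k => π k x) :
    IsStarProjection (avgCLM μ hπ hc) :=
  ⟨isIdempotentElem_avgCLM μ hπ hc, isSelfAdjoint_avgCLM μ hπ hc⟩

/-- the fixed subspace has an orthogonal projection (it is the range of an idempotent bounded operator). -/
theorem hasOrthogonalProjection_fixed [IsProbabilityMeasure μ] [μ.IsMulLeftInvariant] {π : K →* (H →ₗ[ℂ] H)}
    (hπ : T7SupportWeightTorusOrbital.IsUnitaryRep π) (hc : ∀ x, Continuous fun k => π k x) :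
    (fixed π).HasOrthogonalProjection := by
  rw [← range_avgCLM_eq_fixed μ hπ hc]
  exact ContinuousLinearMap.IsIdempotentElem.hasOrthogonalProjection_range (isIdempotentElem_avgCLM μ hπ hc)

/-- `⟪avg x, y⟫ = ⟪x, y⟫` for an invariant `y` (self-adjointness + `avg y = y`). -/
theorem inner_avg_left_of_fixed [μ.IsHaarMeasure] [IsProbabilityMeasure μ] {π : K →* (H →ₗ[ℂ] H)}
    (hπ : T7SupportWeightTorusOrbital.IsUnitaryRep π) (hc : ∀ x, Continuous fun k => π k x) (x : H) {y : H}
    (hy : ∀ k, π k y = y) : ⟪avg μ π x, y⟫_ℂ = ⟪x, y⟫_ℂ := by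
  have hsym := (isSelfAdjoint_avgCLM μ hπ hc).isSymmetric
  have h := hsym x y
  simp only [ContinuousLinearMap.coe_coe] at h
  change ⟪avgCLM μ hπ hc x, y⟫_ℂ = ⟪x, y⟫_ℂ
  rw [h]
  change ⟪x, avg μ π y⟫_ℂ = ⟪x, y⟫_ℂ
  rw [avg_of_fixed μ π hy]

/-- `⟪y, avg x⟫ = ⟪y, x⟫` for an invariant `y`. -/
theorem inner_avg_right_of_fixed [μ.IsHaarMeasure] [IsProbabilityMeasure μ] {π : K →* (H →ₗ[ℂ] H)}
    (hπ : T7SupportWeightTorusOrbital.IsUnitaryRep π) (hc : ∀ x, Continuous fun k => π k x) (x : H) {y : H}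
    (hy : ∀ k, π k y = y) : ⟪y, avg μ π x⟫_ℂ = ⟪y, x⟫_ℂ := by
  rw [← inner_conj_symm, inner_avg_left_of_fixed μ hπ hc x hy, inner_conj_symm]

/-- `x - avg x` is orthogonal to the invariants. -/
theorem sub_avg_mem_orthogonal_fixed [μ.IsHaarMeasure] [IsProbabilityMeasure μ] {π : K →* (H →ₗ[ℂ] H)}
    (hπ : T7SupportWeightTorusOrbital.IsUnitaryRep π) (hc : ∀ x, Continuous fun k => π k x) (x : H) :
    x - avg μ π x ∈ (fixed π)ᗮ := by
  rw [Submodule.mem_orthogonal]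
  intro y hy
  rw [inner_sub_right, inner_avg_right_of_fixed μ hπ hc x ((mem_fixed π y).1 hy), sub_self]

/-- **the averaging operator IS the orthogonal projection onto the invariants**:
`avgCLM = (fixed π).starProjection`. -/
theorem avgCLM_eq_starProjection_fixed [μ.IsHaarMeasure] [IsProbabilityMeasure μ] {π : K →* (H →ₗ[ℂ] H)}
    (hπ : T7SupportWeightTorusOrbital.IsUnitaryRep π) (hc : ∀ x, Continuous fun k => π k x) :
    haveI := hasOrthogonalProjection_fixed μ hπ hc
    avgCLM μ hπ hc = (fixed π).starProjection := by
  haveI := hasOrthogonalProjection_fixed μ hπ hc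
  refine ContinuousLinearMap.ext fun x => ?_
  refine (Submodule.eq_starProjection_of_mem_orthogonal ?_ ?_).symm
  · exact (mem_fixed π _).2 fun k => pi_avg μ hπ hc k x
  · exact sub_avg_mem_orthogonal_fixed μ hπ hc x

omit [TopologicalSpace K] [IsTopologicalGroup K] [CompactSpace K] [BorelSpace K] [CompleteSpace H] in
/-- `‖avg x‖ ≤ ‖x‖` (`μ` a probability). -/
theorem norm_avg_le [IsProbabilityMeasure μ] {π : K →* (H →ₗ[ℂ] H)} (hπ : T7SupportWeightTorusOrbital.IsUnitaryRep π)
    (x : H) : ‖avg μ π x‖ ≤ ‖x‖ := by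
  have h := norm_integratedForm_le μ hπ one x
  simp only [one_apply, norm_one, integral_const, probReal_univ, smul_eq_mul, mul_one, one_mul] at h
  exact h

/-- the average kills the orthogonal complement of the invariants. -/
theorem avg_eq_zero_of_mem_orthogonal_fixed [μ.IsHaarMeasure] [IsProbabilityMeasure μ] {π : K →* (H →ₗ[ℂ] H)}
    (hπ : T7SupportWeightTorusOrbital.IsUnitaryRep π) (hc : ∀ x, Continuous fun k => π k x) {x : H}
    (hx : x ∈ (fixed π)ᗮ) : avg μ π x = 0 := by
  rw [← inner_self_eq_zero (𝕜 := ℂ), inner_avg_left_of_fixed μ hπ hc x (fun k => pi_avg μ hπ hc k x)]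
  exact Submodule.inner_left_of_mem_orthogonal ((mem_fixed π _).2 fun k => pi_avg μ hπ hc k x) hx

end Summit.Ventures.HodgeRepro2.Tier7.Line3.InvariantProjector
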